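/-
Copyright (c) 2026 the pub-hodgecm-mathlib formalisation cell (harness21).  Prover seat hodgecm-mathlib-F0P3-p03 (g12) — (U) road, U4-DISCHARGE (W2)-(n2)-TRANSPORT, FILE (i)
«hypothesis-free congruence transport of μ^TF_w», 2026-09-01.
-/
import Literature.NumberTheory.Weil1964.UnitaryArchLocalTopFormHaarChartMeasure   -- ★ p844889 (A-p06 g29) FILE 4: `archLocalTopFormHaar_eq_cayleyChartMeasureC` (μ^TF_w = ĉ_*(w₀λ|source))
import Literature.NumberTheory.Weil1964.UnitaryArchLocalTopFormHaarCongr          -- ★ p844678 (F0P3-p03 g11): `map_conj_cayleyChartMeasureC` (chart measures under `Ad T`)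
import Literature.NumberTheory.Weil1964.UnitaryArchLocalSkewCongrDiagonal         -- ★ p844697 (F0P3-p03 g11): `exists_conjEquivC_one_of_skewC_eq`, `skewC_neg`
import HarnessLib

/-!
# Hypothesis-free congruence transport of the one-place top-form Haar measure: `(T · T⁻¹)_* μ^TF_w(H₂) = μ^TF_w(H)` for `Tᴴ σ_w(H) T = σ_w(H₂)`, and the same-group case
# ((U) road, U4-DISCHARGE (W2)-(n2)-TRANSPORT, FILE (i); Rogawski 1990 §1.7 «`dg′ = |ψ^*Ω|`»; Helgason 2000 Ch. I §1 Thm. 1.14)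

Topic `NumberTheory/Weil1964`; namespace `Literature.NumberTheory.Weil1964.UnitaryArchLocalTopForm`.  THEOREMS ONLY (no `def`, no instance, no notation, no axiom, no
named fact, no `sorry`).  Cell `pub/hodgecm-mathlib`, crux H413 = `stmt-HodgeConjecture-24833` (supports only).  Count-neutral plumbing.
HONEST LABEL: HC_CM is proved only modulo the 2 remaining named inputs (hLiu418 24832, h413 24833) until rung 0 closes; this file pays nothing by itself.

WHY.  The explicit (R1G) constant of the top-form block measure at an indefinite real diagonal carrier `σ_w diag(β₀, β₂)` (MEMO-U4-NC-v1 (n2)(n4); consumer: A-p19 (g24)'s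
★ p844887 `archLimitFormulaNoncompactWall_clause_wallBlockMap … (C) (hR)`) is read off the STANDARD carrier `U(diag(1,−1))` (where the HAT-BOX disc chart lives) through the
diagonal congruence `T = diag(√|e₀|, √|e₁|)` of ★ (R1G) §3.  That needs the transport `(T · T⁻¹)_* μ^TF_w(H₂) = μ^TF_w(H)` WITHOUT the window hypotheses of ★ p844678
`map_localTopFormHaar_of_conj_of_window`.  With ★ A-p06 (g29) FILE 4 (`μ^TF_w = ĉ_*(w₀ · λ|_{source})` as a MEASURE, for every `c`-hermitian carrier with unit determinant) the
transport is ALGEBRAIC: ★ `map_conj_cayleyChartMeasureC` carries chart measures to chart measures and ★ `image_conjEquivC_cayleySourceC` carries the source onto the source.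
* **`map_conj_archLocalTopFormHaar`**: `Tᴴ σ_w(H) T = σ_w(H₂)`, `Φ = (T · T⁻¹) : U(σ_w H₂)(ℂ) ≃ₜ* U(σ_w H)(ℂ)` ⟹ `Φ_* archLocalTopFormHaar L N H₂ w = archLocalTopFormHaar L N H w`.
* **`map_archLocalTopFormHaar_of_skewC_eq`**: the `T = 1` case — two carriers with `𝔲(σ_w H₂) = 𝔲(σ_w H)` and a `Φ` acting as the identity on matrices (e.g. `H₂ = −H`:
  `U(−J) = U(J)`, ★ `skewC_neg`).
* **`map_archLocalTopFormHaar_neg`**: the instance `H₂ = −H` packaged with ITS OWN `Φ` (`↑(Φ g) = ↑g`), built from the equality of the two subgroups of `GL_N(ℂ)`.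

## References
* [Rogawski1990] J. D. Rogawski, *Automorphic Representations of Unitary Groups in Three Variables*, Ann. of Math. Stud. 123 (1990), §1.7 p. 6.
* [Helgason2000] S. Helgason, *Groups and Geometric Analysis*, AMS Math. Surveys Monogr. 83 (2000), Ch. I §1 Thm. 1.14 (13) p. 96.
* [Knapp2002] A. W. Knapp, *Lie Groups Beyond an Introduction*, 2nd ed. (2002), I §1.
-/

set_option autoImplicit false
-- the scoped normed structure on the submodule `𝔲(Jw) ≤ M_N(ℂ)` vs the `[BorelSpace ↥(skewC …)]` binder's subtype topology (as in ★ U1 FILE B ∕ ★ FILE 4)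
set_option backward.isDefEq.respectTransparency false

noncomputable section

open Set Filter Topology MeasureTheory MeasureTheory.Measure NumberField NumberField.InfinitePlace Literature.Analysis.Calculus
open scoped Classical Matrix Matrix.Norms.Operator MatrixGroups ENNReal NNReal Pointwise

namespace Literature.NumberTheory.Weil1964

namespace UnitaryArchLocalTopForm

open Literature.NumberTheory.Automorphic Literature.NumberTheory.Automorphic.UnitaryGroup

section CM

variable (L : Type) [Field L] [NumberField L] [IsCMField L] (N : ℕ) (H H₂ : Matrix (Fin N) (Fin N) L)

/-- **CONGRUENCE TRANSPORT OF `μ^TF_w`, HYPOTHESIS-FREE.**  For two `c`-hermitian carriers `H, H₂` with unit determinants over the CM field `L`, a complex place `w`, and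
`T ∈ GL_N(ℂ)` with `Tᴴ (σ_w H) T = σ_w H₂`, the congruence `Φ = (T · T⁻¹) : U(σ_w H₂)(ℂ) ≃ₜ* U(σ_w H)(ℂ)` carries `archLocalTopFormHaar L N H₂ w` to `archLocalTopFormHaar L N H w`
(★ FILE 4 on both sides + ★ `map_conj_cayleyChartMeasureC` + ★ `image_conjEquivC_cayleySourceC`; no Haar uniqueness, no window hypothesis).
[cite: Rogawski1990, §1.7 p. 6] [cite: Helgason2000, Ch. I §1 Thm. 1.14 (13) p. 96] -/
theorem map_conj_archLocalTopFormHaar (hherm : (H.map (IsCMField.complexConj L))ᵀ = H) (hdet : IsUnit H.det)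
    (hherm₂ : (H₂.map (IsCMField.complexConj L))ᵀ = H₂) (hdet₂ : IsUnit H₂.det)
    (w : {w : InfinitePlace L // IsComplex w}) [MeasurableSpace (GL (Fin N) ℂ)] [BorelSpace (GL (Fin N) ℂ)]
    {T : GL (Fin N) ℂ} (h : formCongr (starRingEnd ℂ) T (H.map w.1.embedding) = H₂.map w.1.embedding)
    (Φ : unitaryGroupOfForm (starRingEnd ℂ) (H₂.map w.1.embedding) ≃ₜ* unitaryGroupOfForm (starRingEnd ℂ) (H.map w.1.embedding))
    (hΦ : ∀ g : unitaryGroupOfForm (starRingEnd ℂ) (H₂.map w.1.embedding),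
      ((Φ g : unitaryGroupOfForm (starRingEnd ℂ) (H.map w.1.embedding)) : GL (Fin N) ℂ) = T * (g : GL (Fin N) ℂ) * T⁻¹) :
    Measure.map Φ (archLocalTopFormHaar L N H₂ w) = archLocalTopFormHaar L N H w := by
  letI : MeasurableSpace ↥(skewC N (H.map w.1.embedding)) := borel _
  haveI : BorelSpace ↥(skewC N (H.map w.1.embedding)) := ⟨rfl⟩
  letI : MeasurableSpace ↥(skewC N (H₂.map w.1.embedding)) := borel _
  haveI : BorelSpace ↥(skewC N (H₂.map w.1.embedding)) := ⟨rfl⟩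
  obtain ⟨e, he⟩ := exists_conjEquivC (Jw := H.map w.1.embedding) (Jw₂ := H₂.map w.1.embedding) h
  rw [archLocalTopFormHaar_eq_cayleyChartMeasureC L N H₂ hherm₂ hdet₂ w, archLocalTopFormHaar_eq_cayleyChartMeasureC L N H hherm hdet w,
    map_conj_cayleyChartMeasureC Φ hΦ e he subset_rfl isOpen_cayleySourceC.measurableSet, image_conjEquivC_cayleySourceC e he]

/-- **THE `T = 1` CASE: two carriers with the SAME unitary group.**  If `𝔲(σ_w H₂) = 𝔲(σ_w H)` and `Φ : U(σ_w H₂)(ℂ) ≃ₜ* U(σ_w H)(ℂ)` acts as the identity on matrices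
(`↑(Φ g) = ↑g`; e.g. `H₂ = −H` or `H₂ = r • H`, `r` real non-zero), then `Φ_* archLocalTopFormHaar L N H₂ w = archLocalTopFormHaar L N H w`.
[cite: Rogawski1990, §1.7 p. 6] [cite: Knapp2002, I §1] -/
theorem map_archLocalTopFormHaar_of_skewC_eq (hherm : (H.map (IsCMField.complexConj L))ᵀ = H) (hdet : IsUnit H.det)
    (hherm₂ : (H₂.map (IsCMField.complexConj L))ᵀ = H₂) (hdet₂ : IsUnit H₂.det)
    (w : {w : InfinitePlace L // IsComplex w}) [MeasurableSpace (GL (Fin N) ℂ)] [BorelSpace (GL (Fin N) ℂ)]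
    (hS : skewC N (H₂.map w.1.embedding) = skewC N (H.map w.1.embedding))
    (Φ : unitaryGroupOfForm (starRingEnd ℂ) (H₂.map w.1.embedding) ≃ₜ* unitaryGroupOfForm (starRingEnd ℂ) (H.map w.1.embedding))
    (hΦ : ∀ g : unitaryGroupOfForm (starRingEnd ℂ) (H₂.map w.1.embedding),
      ((Φ g : unitaryGroupOfForm (starRingEnd ℂ) (H.map w.1.embedding)) : GL (Fin N) ℂ) = (g : GL (Fin N) ℂ)) :
    Measure.map Φ (archLocalTopFormHaar L N H₂ w) = archLocalTopFormHaar L N H w := by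
  letI : MeasurableSpace ↥(skewC N (H.map w.1.embedding)) := borel _
  haveI : BorelSpace ↥(skewC N (H.map w.1.embedding)) := ⟨rfl⟩
  letI : MeasurableSpace ↥(skewC N (H₂.map w.1.embedding)) := borel _
  haveI : BorelSpace ↥(skewC N (H₂.map w.1.embedding)) := ⟨rfl⟩
  obtain ⟨e, he⟩ := exists_conjEquivC_one_of_skewC_eq (Jw := H.map w.1.embedding) (Jw₂ := H₂.map w.1.embedding) hS
  have hΦ' : ∀ g : unitaryGroupOfForm (starRingEnd ℂ) (H₂.map w.1.embedding),
      ((Φ g : unitaryGroupOfForm (starRingEnd ℂ) (H.map w.1.embedding)) : GL (Fin N) ℂ) = 1 * (g : GL (Fin N) ℂ) * 1⁻¹ := fun g => by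
    rw [hΦ, one_mul, inv_one, mul_one]
  rw [archLocalTopFormHaar_eq_cayleyChartMeasureC L N H₂ hherm₂ hdet₂ w, archLocalTopFormHaar_eq_cayleyChartMeasureC L N H hherm hdet w,
    map_conj_cayleyChartMeasureC Φ hΦ' e he subset_rfl isOpen_cayleySourceC.measurableSet, image_conjEquivC_cayleySourceC e he]

omit [IsCMField L] in
/-- `U(σ_w(−H))(ℂ) = U(σ_w H)(ℂ)` as subgroups of `GL_N(ℂ)` (`gᴴ (−J) g = −J ↔ gᴴ J g = J`). [cite: Knapp2002, I §1] -/
theorem unitaryGroupOfForm_map_neg_eq (w : {w : InfinitePlace L // IsComplex w}) :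
    unitaryGroupOfForm (starRingEnd ℂ) ((-H).map w.1.embedding) = unitaryGroupOfForm (starRingEnd ℂ) (H.map w.1.embedding) := by
  have hneg : (-H).map w.1.embedding = -(H.map w.1.embedding) := Matrix.map_neg _ (map_neg _) _
  ext g
  rw [hneg, mem_unitaryGroupOfForm_iff, mem_unitaryGroupOfForm_iff, Matrix.mul_neg, Matrix.neg_mul, neg_inj]

omit [IsCMField L] in
/-- `𝔲(σ_w(−H)) = 𝔲(σ_w H)` (★ `skewC_neg`). [cite: Knapp2002, I §1] -/
theorem skewC_map_neg_eq (w : {w : InfinitePlace L // IsComplex w}) :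
    skewC N ((-H).map w.1.embedding) = skewC N (H.map w.1.embedding) := by
  rw [show (-H).map w.1.embedding = -(H.map w.1.embedding) from Matrix.map_neg _ (map_neg _) _, skewC_neg]

/-- **THE SIGN FLIP `H ↦ −H` WITH ITS OWN `Φ`.**  There is a `Φ : U(σ_w(−H))(ℂ) ≃ₜ* U(σ_w H)(ℂ)` acting as the identity on matrices, and it carries
`archLocalTopFormHaar L N (−H) w` to `archLocalTopFormHaar L N H w` (for `H` `c`-hermitian with unit determinant). [cite: Rogawski1990, §1.7 p. 6] [cite: Knapp2002, I §1] -/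
theorem map_archLocalTopFormHaar_neg (hherm : (H.map (IsCMField.complexConj L))ᵀ = H) (hdet : IsUnit H.det)
    (w : {w : InfinitePlace L // IsComplex w}) [MeasurableSpace (GL (Fin N) ℂ)] [BorelSpace (GL (Fin N) ℂ)] :
    ∃ Φ : unitaryGroupOfForm (starRingEnd ℂ) ((-H).map w.1.embedding) ≃ₜ* unitaryGroupOfForm (starRingEnd ℂ) (H.map w.1.embedding),
      (∀ g : unitaryGroupOfForm (starRingEnd ℂ) ((-H).map w.1.embedding),
        ((Φ g : unitaryGroupOfForm (starRingEnd ℂ) (H.map w.1.embedding)) : GL (Fin N) ℂ) = (g : GL (Fin N) ℂ)) ∧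
      Measure.map Φ (archLocalTopFormHaar L N (-H) w) = archLocalTopFormHaar L N H w := by
  have hU := unitaryGroupOfForm_map_neg_eq L N H w
  -- the identity of subgroups as a continuous multiplicative equivalence
  let Φ₀ : unitaryGroupOfForm (starRingEnd ℂ) ((-H).map w.1.embedding) ≃* unitaryGroupOfForm (starRingEnd ℂ) (H.map w.1.embedding) := MulEquiv.subgroupCongr hU
  have hΦ₀ : ∀ g : unitaryGroupOfForm (starRingEnd ℂ) ((-H).map w.1.embedding),
      ((Φ₀ g : unitaryGroupOfForm (starRingEnd ℂ) (H.map w.1.embedding)) : GL (Fin N) ℂ) = (g : GL (Fin N) ℂ) := fun _ => rfl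
  have hc : Continuous Φ₀ := by
    refine Continuous.subtype_mk ?_ _
    exact continuous_subtype_val
  have hc' : Continuous Φ₀.symm := by
    refine Continuous.subtype_mk ?_ _
    exact continuous_subtype_val
  let Φ : unitaryGroupOfForm (starRingEnd ℂ) ((-H).map w.1.embedding) ≃ₜ* unitaryGroupOfForm (starRingEnd ℂ) (H.map w.1.embedding) :=
    { Φ₀ with continuous_toFun := hc, continuous_invFun := hc' }
  have hΦ : ∀ g : unitaryGroupOfForm (starRingEnd ℂ) ((-H).map w.1.embedding),
      ((Φ g : unitaryGroupOfForm (starRingEnd ℂ) (H.map w.1.embedding)) : GL (Fin N) ℂ) = (g : GL (Fin N) ℂ) := fun _ => rfl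
  have hherm' : ((-H).map (IsCMField.complexConj L))ᵀ = -H := by
    rw [Matrix.map_neg _ (map_neg _), Matrix.transpose_neg, hherm]
  have hdet' : IsUnit (-H).det := by
    rw [Matrix.det_neg]; exact ((isUnit_neg_one.pow _)).mul hdet
  exact ⟨Φ, hΦ, map_archLocalTopFormHaar_of_skewC_eq L N H (-H) hherm hdet hherm' hdet' w (skewC_map_neg_eq L N H w) Φ hΦ⟩

end CM

end UnitaryArchLocalTopForm

end Literature.NumberTheory.Weil1964

end
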